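import Summits.ResolutionOfSingularities.KangarooAtlas.MizutaniPointMultiplicity
import Literature.AlgebraicGeometry.Resolution.OrderGenerization
import Mathlib.RingTheory.RegularLocalRing.Polynomial
import HarnessLib

/-!
# Mizutani's conjecture — `U_m(𝔭) ⊆ U_m(𝔮)` for ALL forms under specialisation `𝔭 ⊆ 𝔮` (Zariski–Nagata), and the
# upper semicontinuity of `mult_𝔭(Proj(S/fS))`

Cell topic `Summits/ResolutionOfSingularities/KangarooAtlas` (pub-rosobs); namespace
`Summit.ResolutionOfSingularities.KangarooAtlas.Mizutani`.  Companion to the Lean transcription of the in-house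
note MIZUTANI-PROOF-g59 (AI-written, AI-audited; *AI review is weaker than expert review*; not a resolution
theorem; NOT summit progress).

`MizutaniSpecialization.lean` (encloser-2 g5) proved the specialisation behaviour of Hironaka's objects — `U(𝔭) ⊆ U(𝔮)`,
`U_+(𝔭)S ⊆ U_+(𝔮)S`, `B_{P,𝔮} ⊆ B_{P,𝔭}` for POINTS `𝔭 ⊆ 𝔮` — by transport through Oda's equality and Hironaka's
generation theorem (additive forms), noting that «a direct proof would need the monotonicity of symbolic powers
`𝔭^{(d)} ⊆ 𝔮^{(d)}` of regular rings (Zariski–Nagata), not in the tree».  That monotonicity IS in the tree, in cell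
res-hironaka's `Literature/…/Resolution/OrderGenerization.lean` (`mem_pow_of_mul_mem_pow`: in a regular local ring
`(R, 𝔪)`, `s x ∈ Pⁿ` with `s ∉ P` prime implies `x ∈ 𝔪ⁿ` — Zariski's `P^{(n)} ⊆ 𝔪ⁿ`, Nagata (38.3), via Cossart–Piltant
2008 Prop. 4.2).  This file draws the consequences for Mizutani's vocabulary, for ALL forms and ALL primes:

* `exists_mul_mem_pow_of_le` — in ANY regular ring (Mathlib `IsRegularRing`), primes `P ⊆ Q`, `s x ∈ P^m` with `s ∉ P`
  ⇒ `u x ∈ Q^m` for some `u ∉ Q` (`P^{(m)} ⊆ Q^{(m)}`, Zariski–Nagata monotonicity, delocalised);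
* **`symbPow_subset_symbPow_of_le`** — for primes `𝔭 ⊆ 𝔮` of `k[X_σ]` (`σ` finite, `k` any field):
  `𝔭^{(m)} ⊆ 𝔮^{(m)}` («`mult_𝔭 f ≥ m ⇒ mult_𝔮 f ≥ m`»: multiplicity does not drop under specialisation);
* `multGens_subset_of_le`, `multAlgebra_le_of_le`, `bIdeal_le_of_le` — `U_m(𝔭) ⊆ U_m(𝔮)`, `U(𝔭) ⊆ U(𝔮)`,
  `U_+(𝔭)S ⊆ U_+(𝔮)S` for every pair of primes `𝔭 ⊆ 𝔮` (no `IsPoint`, no Oda, no generation theorem; Mizutani §1 (d)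
  «the most generic point associated with an H-scheme»);
* **`projMult_mono`** — for points `𝔭 ⊆ 𝔮` of `ℙⁿ_k` and a nonzero form `f`:
  `mult_𝔭(Proj(S/fS)) ≤ mult_𝔮(Proj(S/fS))` — the multiplicity of a projective hypersurface (Samuel multiplicity of
  its local ring, `projMult` of `MizutaniPointMultiplicity.lean`) is UPPER SEMICONTINUOUS along specialisation,
  over every field;
* `projMult_eq_degree_mono` — hence the locus `{𝔭 : mult_𝔭 = deg f}` of points at which `f` is a «cone» is closed
  under specialisation;
* `projMult_eq_adicOrder'`, **`projMult_mul`**, `projMult_pow`, `projMult_linear` — «mult = ν» for every nonzero form,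
  ADDITIVITY `mult_𝔭(φψ) = mult_𝔭(φ) + mult_𝔭(ψ)` (the order of the regular local ring `𝒪_{ℙⁿ,𝔭}` is a valuation,
  tree `adicOrder_mul`), powers, and linear forms (multiplicity `1` on their hyperplane, `0` off it).

References: [Mizutani1973HironakaGroupSchemes] §1 (d) p. 86, p. 85 L21–29; [CossartPiltant2008] Prop. 4.2 (proof);
Zariski–Samuel II / Nagata *Local Rings* (38.3) (background, not cited as tree facts); [Matsumura1987] §14.
-/

noncomputable section

open MvPolynomial IsLocalRing Literature.RingTheory.HilbertSamuel Literature.AlgebraicGeometry.Resolution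
  Literature.AlgebraicGeometry.Resolution.HironakaScheme

attribute [local instance] MvPolynomial.gradedAlgebra

namespace Summit.ResolutionOfSingularities.KangarooAtlas.Mizutani

universe u v

/-! ### Zariski–Nagata monotonicity of the symbolic powers of primes in a regular ring -/

section RegularRing

variable {R : Type u} [CommRing R] [IsRegularRing R] {P Q : Ideal R} [hPp : P.IsPrime] [hQp : Q.IsPrime]

/-- **Symbolic powers of primes are monotone in a REGULAR ring**: if `P ⊆ Q` are primes of a regular ring `R`
(Mathlib `IsRegularRing`: Noetherian with regular localisations) and `s x ∈ P^m` for some `s ∉ P` (`x ∈ P^{(m)}`), then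
`u x ∈ Q^m` for some `u ∉ Q` (`x ∈ Q^{(m)}`).  This is Zariski's `P^{(m)} ⊆ 𝔪^m` in the regular local ring `R_Q` (tree:
`mem_pow_of_mul_mem_pow`, `OrderGenerization.lean`, Cossart–Piltant 2008 Prop. 4.2 — «the order does not increase under
generization»), delocalised. [cite: CossartPiltant2008, Prop. 4.2 (proof)] -/
theorem exists_mul_mem_pow_of_le (h : P ≤ Q) {m : ℕ} {x s : R} (hs : s ∉ P) (hsx : s * x ∈ P ^ m) :
    ∃ u ∉ Q, u * x ∈ Q ^ m := by
  haveI : IsRegularLocalRing (Localization.AtPrime Q) := IsRegularRing.isRegularLocalRing_localization Q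
  have hdisj : Disjoint (Q.primeCompl : Set R) P := disjoint_primeCompl_of_le h
  haveI hP' : (P.map (algebraMap R (Localization.AtPrime Q))).IsPrime :=
    IsLocalization.isPrime_of_isPrime_disjoint Q.primeCompl _ P hPp hdisj
  have hs' : algebraMap R (Localization.AtPrime Q) s ∉ P.map (algebraMap R (Localization.AtPrime Q)) := by
    intro hmem
    have hc : s ∈ (P.map (algebraMap R (Localization.AtPrime Q))).under R := hmem
    rw [IsLocalization.under_map_of_isPrime_disjoint Q.primeCompl (Localization.AtPrime Q) hPp hdisj] at hc
    exact hs hc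
  have hsx' : algebraMap R (Localization.AtPrime Q) s * algebraMap R (Localization.AtPrime Q) x ∈
      P.map (algebraMap R (Localization.AtPrime Q)) ^ m := by
    rw [← map_mul, ← Ideal.map_pow]
    exact Ideal.mem_map_of_mem _ hsx
  have hx' := mem_pow_of_mul_mem_pow _ hs' hsx'
  -- delocalise `x/1 ∈ 𝔪_{R_Q}^m = (Q^m) R_Q`
  rw [← Localization.AtPrime.map_eq_maximalIdeal, ← Ideal.map_pow,
    IsLocalization.mem_map_algebraMap_iff Q.primeCompl] at hx'
  obtain ⟨⟨⟨a, ha⟩, ⟨u, hu⟩⟩, hux⟩ := hx'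
  have hxu : algebraMap R (Localization.AtPrime Q) (x * u) = algebraMap R (Localization.AtPrime Q) a := by
    rw [map_mul]
    exact hux
  obtain ⟨⟨c, hc⟩, hcx⟩ := (IsLocalization.eq_iff_exists Q.primeCompl _).mp hxu
  replace hcx : c * (x * u) = c * a := hcx
  refine ⟨c * u, fun hmem => (hQp.mem_or_mem hmem).elim hc hu, ?_⟩
  have e : c * u * x = c * (x * u) := by ring
  rw [e, hcx]
  exact Ideal.mul_mem_left _ _ ha

end RegularRing

/-! ### The polynomial ring: `𝔭^{(m)} ⊆ 𝔮^{(m)}`, `U(𝔭) ⊆ U(𝔮)`, `U_+(𝔭)S ⊆ U_+(𝔮)S` for all primes `𝔭 ⊆ 𝔮` -/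

section SymbPow

variable {k : Type u} [Field k] {σ : Type v} [Finite σ]
  {𝔭 𝔮 : Ideal (MvPolynomial σ k)} [h𝔭 : 𝔭.IsPrime] [h𝔮 : 𝔮.IsPrime]

/-- **`𝔭^{(m)} ⊆ 𝔮^{(m)}` for primes `𝔭 ⊆ 𝔮` of a polynomial ring in finitely many variables over a field** (a regular
ring, Mathlib `MvPolynomial.isRegularRing_of_isRegularRing`): «`mult_𝔭 f ≥ m ⇒ mult_𝔮 f ≥ m`» for EVERY `f`, not only
for additive forms. [cite: CossartPiltant2008, Prop. 4.2 (proof: the order does not increase under generization)] -/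
theorem symbPow_subset_symbPow_of_le (h : 𝔭 ≤ 𝔮) (m : ℕ) : symbPow k 𝔭 m ⊆ symbPow k 𝔮 m :=
  fun _ ⟨_, hs, hsf⟩ => exists_mul_mem_pow_of_le h hs hsf

/-- Hence `U_m(𝔭) ⊆ U_m(𝔮)` on the homogeneous generators: `multGens k 𝔭 ⊆ multGens k 𝔮` for primes `𝔭 ⊆ 𝔮`.
[cite: Mizutani1973HironakaGroupSchemes, §1 (d) p. 86 and p. 85 L21–25] -/
theorem multGens_subset_of_le (h : 𝔭 ≤ 𝔮) : multGens k 𝔭 ⊆ multGens k 𝔮 :=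
  fun _ ⟨d, hφd, hφs⟩ => ⟨d, hφd, symbPow_subset_symbPow_of_le h d hφs⟩

/-- **`U(𝔭) ⊆ U(𝔮)` for every pair of primes `𝔭 ⊆ 𝔮`** (no `IsPoint`, no Oda equality, no generation theorem — compare
`multAlgebra_mono` of `MizutaniSpecialization.lean`). [cite: Mizutani1973HironakaGroupSchemes, §1 (d) p. 86 («the most generic point associated with an H-scheme»)] -/
theorem multAlgebra_le_of_le (h : 𝔭 ≤ 𝔮) : multAlgebra k 𝔭 ≤ multAlgebra k 𝔮 :=
  Algebra.adjoin_mono (multGens_subset_of_le h)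

/-- **`U_+(𝔭)S ⊆ U_+(𝔮)S`**, i.e. `B_{P,𝔮} ⊆ B_{P,𝔭}`, for every pair of primes `𝔭 ⊆ 𝔮` (compare `bIdeal_mono`).
[cite: Mizutani1973HironakaGroupSchemes, §1 (d) p. 86 and Def. 1.1] -/
theorem bIdeal_le_of_le (h : 𝔭 ≤ 𝔮) : bIdeal k 𝔭 ≤ bIdeal k 𝔮 :=
  Ideal.span_mono (Set.inter_subset_inter_left _ fun _ hu => multAlgebra_le_of_le h hu)

end SymbPow

/-! ### Upper semicontinuity of `mult_𝔭(Proj(S/fS))` on `ℙⁿ` -/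

section Points

variable {k : Type u} [Field k] {n : ℕ}
  {𝔭 𝔮 : Ideal (MvPolynomial (Fin (n + 1)) k)} [h𝔭 : 𝔭.IsPrime] [h𝔮 : 𝔮.IsPrime]

/-- **The multiplicity of a projective hypersurface is upper semicontinuous along specialisation**: for points
`𝔭 ⊆ 𝔮` of `ℙⁿ_k` (`𝔮` in the closure of `𝔭`) and a nonzero form `f` of degree `d`,
`mult_𝔭(Proj(S/fS)) ≤ mult_𝔮(Proj(S/fS))` — with `mult` the Samuel multiplicity of the local ring of the hypersurface at
the point (`projMult`), over EVERY field `k`.  (Zariski–Nagata in `𝒪_{ℙⁿ,𝔮}` through `symbPow_subset_symbPow_of_le` and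
`mem_symbPow_iff_le_projMult`.) [cite: CossartPiltant2008, Prop. 4.2 (proof); Mizutani1973HironakaGroupSchemes, §1 (d) p. 86; Matsumura1987, §14] -/
theorem projMult_mono (hP : IsPoint k 𝔭) (hQ : IsPoint k 𝔮) (h : 𝔭 ≤ 𝔮) {d : ℕ}
    {φ : MvPolynomial (Fin (n + 1)) k} (hφ : φ ∈ homogeneousSubmodule (Fin (n + 1)) k d) (hφ0 : φ ≠ 0) :
    projMult 𝔭 hP d φ ≤ projMult 𝔮 hQ d φ :=
  (mem_symbPow_iff_le_projMult hQ hφ hφ0 _).mp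
    (symbPow_subset_symbPow_of_le h _ ((mem_symbPow_iff_le_projMult hP hφ hφ0 _).mpr le_rfl))

/-- Hence the locus of points at which a nonzero form `f` of degree `d` has multiplicity EQUAL to its degree
(`f ∈ U_d`, a «cone through the point») is closed under specialisation: `mult_𝔭 = d ⇒ mult_𝔮 = d` for `𝔭 ⊆ 𝔮`.
[cite: Mizutani1973HironakaGroupSchemes, §1 (d) p. 86 and p. 85 L23–25] -/
theorem projMult_eq_degree_mono (hP : IsPoint k 𝔭) (hQ : IsPoint k 𝔮) (h : 𝔭 ≤ 𝔮) {d : ℕ}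
    {φ : MvPolynomial (Fin (n + 1)) k} (hφ : φ ∈ homogeneousSubmodule (Fin (n + 1)) k d) (hφ0 : φ ≠ 0)
    (hd : projMult 𝔭 hP d φ = d) : projMult 𝔮 hQ d φ = d := by
  refine le_antisymm (projMult_le_degree hQ hφ hφ0) ?_
  have hle := projMult_mono hP hQ h hφ hφ0
  rwa [hd] at hle

/-- The point itself versus the generic point of `ℙⁿ` (`𝔭 = ⊥`, on no hypersurface): `mult_⊥ f = 0 ≤ mult_𝔮 f` — recorded
as the statement that a nonzero form has multiplicity `0` at the generic point. [cite: Mizutani1973HironakaGroupSchemes, p. 85 L21–25 (U_0 = S_0)] -/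
theorem projMult_bot (hB : IsPoint k (⊥ : Ideal (MvPolynomial (Fin (n + 1)) k))) (d : ℕ)
    {φ : MvPolynomial (Fin (n + 1)) k} (hφ0 : φ ≠ 0) :
    projMult (h𝔭 := Ideal.isPrime_bot) ⊥ hB d φ = 0 :=
  projMult_of_not_mem (h𝔭 := Ideal.isPrime_bot) hB d (by rwa [Ideal.mem_bot])

end Points

/-! ### Products: `mult` is additive on forms (the order valuation of `𝒪_{ℙⁿ,𝔭}`) -/

section Products

variable {k : Type u} [Field k] {n : ℕ}
  {𝔭 : Ideal (MvPolynomial (Fin (n + 1)) k)} [h𝔭 : 𝔭.IsPrime]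

/-- **`mult = ν` for every nonzero form** (on or off the hypersurface): `projMult 𝔭 hP d φ = ν(φ/X_i^d) ∈ ℕ∞` in any chart
`X_i ∉ 𝔭` — on the hypersurface by `projMult_eq_adicOrder`, off it both sides are `0` (the germ is a unit).
[cite: Hironaka1970NumericalCharacters, p. 154 L24–29; Matsumura1987, §14] -/
theorem projMult_eq_adicOrder' (hP : IsPoint k 𝔭) {i : Fin (n + 1)}
    (hi : (X i : MvPolynomial (Fin (n + 1)) k) ∉ 𝔭) {d : ℕ} {φ : MvPolynomial (Fin (n + 1)) k}
    (hφ : φ ∈ homogeneousSubmodule (Fin (n + 1)) k d) (hφ0 : φ ≠ 0) :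
    (projMult 𝔭 hP d φ : ℕ∞) =
      adicOrder (projGerm 𝔭 (X i) (Literature.AlgebraicGeometry.Motives.ProjectiveSpace.X_mem i) hi d φ hφ) := by
  by_cases hφ𝔭 : φ ∈ 𝔭
  · exact projMult_eq_adicOrder hP hi hφ hφ𝔭 hφ0
  · rw [projMult_of_not_mem hP d hφ𝔭, Nat.cast_zero,
      adicOrder_of_isUnit ((isUnit_projGerm_iff _ hi d φ hφ).mpr hφ𝔭)]

/-- **ADDITIVITY `mult_𝔭(φψ) = mult_𝔭(φ) + mult_𝔭(ψ)`** for nonzero forms `φ ∈ S_a`, `ψ ∈ S_b` at every point of `ℙⁿ_k`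
(the order of `𝒪_{ℙⁿ,𝔭}`, a regular local ring, is a valuation: `adicOrder_mul`) — consistent with «`U(p)` is a
subalgebra» (products of forms of multiplicity `=` degree have multiplicity `=` degree).
[cite: Mizutani1973HironakaGroupSchemes, p. 85 L21–25 (U(p) a graded k-algebra); ZariskiSamuel1960, Ch. VIII §1 Thm. 1] -/
theorem projMult_mul (hP : IsPoint k 𝔭) {a b : ℕ} {φ ψ : MvPolynomial (Fin (n + 1)) k}
    (hφ : φ ∈ homogeneousSubmodule (Fin (n + 1)) k a) (hψ : ψ ∈ homogeneousSubmodule (Fin (n + 1)) k b)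
    (hφ0 : φ ≠ 0) (hψ0 : ψ ≠ 0) :
    projMult 𝔭 hP (a + b) (φ * ψ) = projMult 𝔭 hP a φ + projMult 𝔭 hP b ψ := by
  obtain ⟨i, hi⟩ := exists_X_not_mem_of_isPoint 𝔭 hP
  haveI := isRegularLocalRing_projLocalRing 𝔭 hP
  have hφψ : φ * ψ ∈ homogeneousSubmodule (Fin (n + 1)) k (a + b) := SetLike.mul_mem_graded hφ hψ
  have hφψ0 : φ * ψ ≠ 0 := mul_ne_zero hφ0 hψ0
  have h := projMult_eq_adicOrder' hP hi hφψ hφψ0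
  rw [projGerm_mul (Literature.AlgebraicGeometry.Motives.ProjectiveSpace.X_mem i) hi rfl φ ψ hφ hψ hφψ,
    adicOrder_mul, ← projMult_eq_adicOrder' hP hi hφ hφ0, ← projMult_eq_adicOrder' hP hi hψ hψ0,
    ← Nat.cast_add, Nat.cast_inj] at h
  exact h

/-- `mult_𝔭(φ^j) = j · mult_𝔭(φ)` for a nonzero form `φ`. [cite: ZariskiSamuel1960, Ch. VIII §1 Thm. 1; Matsumura1987, §14] -/
theorem projMult_pow (hP : IsPoint k 𝔭) {d : ℕ} {φ : MvPolynomial (Fin (n + 1)) k}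
    (hφ : φ ∈ homogeneousSubmodule (Fin (n + 1)) k d) (hφ0 : φ ≠ 0) (j : ℕ) :
    projMult 𝔭 hP (j * d) (φ ^ j) = j * projMult 𝔭 hP d φ := by
  induction j with
  | zero =>
    rw [zero_mul, zero_mul, pow_zero]
    have h1 : (1 : MvPolynomial (Fin (n + 1)) k) ∉ 𝔭 := (Ideal.ne_top_iff_one 𝔭).mp h𝔭.ne_top
    exact projMult_of_not_mem hP 0 h1
  | succ j ih =>
    have hpow : φ ^ j ∈ homogeneousSubmodule (Fin (n + 1)) k (j * d) := SetLike.pow_mem_graded j hφ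
    rw [pow_succ, Nat.succ_mul, projMult_mul hP hpow hφ (pow_ne_zero j hφ0) hφ0, ih, Nat.succ_mul]

/-- A LINEAR form `ℓ ≠ 0` has multiplicity `1` at the points of its hyperplane and `0` elsewhere.
[cite: Mizutani1973HironakaGroupSchemes, p. 85 L21–25; Matsumura1987, §14] -/
theorem projMult_linear (hP : IsPoint k 𝔭) {ℓ : MvPolynomial (Fin (n + 1)) k}
    (hℓ : ℓ ∈ homogeneousSubmodule (Fin (n + 1)) k 1) (hℓ0 : ℓ ≠ 0) [Decidable (ℓ ∈ 𝔭)] :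
    projMult 𝔭 hP 1 ℓ = if ℓ ∈ 𝔭 then 1 else 0 := by
  split_ifs with hℓ𝔭
  · exact le_antisymm (projMult_le_degree hP hℓ hℓ0) ((projMult_pos_iff hP hℓ hℓ0).mpr hℓ𝔭)
  · exact projMult_of_not_mem hP 1 hℓ𝔭

end Products

end Summit.ResolutionOfSingularities.KangarooAtlas.Mizutani

end
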